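import Literature.NumberTheory.EllipticCurves.Kato2004.AdditivePotGoodRankZeroShaUpperBoundFineSelmer
import HarnessLib

/-!
# Kato 2004 at the prime `p = 2`: the rank-`0` upper bound at an ADDITIVE, POTENTIALLY GOOD `2` for `E[2]` IRREDUCIBLE and NEGATIVE discriminant, granted Coates–Sujatha's statement (A) at `(E, 2)` — `ord₂ #Ш(E/ℚ)[2^∞] + v₂(Tam E) ≤ ord₂(L(E,1)/Ω_E) + 1` (ONE named fact; a READING of Kato's proofs at `p = 2`, weaker than what they give at odd `p` by the displayed `+ 1`)

Topic `NumberTheory/EllipticCurves`, sub-directory `Kato2004` (namespace = path). ONE named fact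
(`def … : Prop`, D-0014), nothing else. It is the `p = 2` twin of the sibling reading
`Kato2004.rankZero_padicValNat_sha_add_padicValNat_tamagawa_le_of_additive_potGood_of_irreducible_of_fineSelmerDual_fg`
(file `Kato2004/AdditivePotGoodRankZeroShaUpperBoundFineSelmer.lean`, whose module docstring carries
the verbatim statements of Kato's 12.2, Thm. 12.4, Thm. 12.5 (3)(4), Thm. 12.6, Thm. 13.4, 13.14,
Thm. 14.5, 14.14 + Lemma 14.15, Prop. 14.16, §14.8, Lim 2017 §3 and the derivation items 1–9; not
repeated here). That sibling carries `p ≠ 2` because FIVE of its printed steps do: Kato's Thm. 12.4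
(3) ("If `p ≠ 2` …", freeness of `𝐇¹(T)`), the proof 14.14 of Thm. 14.5 (3) ("Since `Λ` is a finite
product of regular local rings, `𝔭` is a principal ideal" — false at `p = 2`, where
`Λ = ℤ₂[[ℤ₂^×]]`, Kato 1999 [KK4] Prop. 10.5 (4)), the proof of Prop. 14.16 ("since the
`p`-cohomological dimension of `Spec(ℤ[1/p])` is `2`" and the sequences (14.9.1)–(14.9.4), which
Kato prints "exact in the case `p ≠ 2`, and exact upto `×2` in the case `p = 2`", p. 239), C.-H.
Kim's local index Lemma 3.10 ("additive reduction at `p ≥ 3`"), and the period normalisation (the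
`±`-parts of `H¹(E(ℂ), ℤ_p)` and `H₁(E(ℂ), ℤ_p)` pair perfectly for odd `p`). This file records
what the SAME printed arguments give at `p = 2` when each of the five is replaced as follows — the
reading is written for the referee step by step (items T1–T10 below); every non-verbatim step is an
elementary lemma stated in full. Written by the prover seat `bsd-2adic-addL2x` GEN 5 (cell
`bsd-2adic`, rung K4, crux stmt-BirchSwinnertonDyer-19098 `AdditiveRankZeroAtTwo`, defect-`≥ 3`
sub-class: 1 382 classes of analytic rank `0`, additive and potentially supersingular at `2`), to
NAME the `∀`-upper half `hU3` of that crux (`stub_addDefectUpper`, «Kato 14.5 (3) prints p ≠ 2: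
outside print») as: PRINT-BY-PROOF at `2` ⊕ statement (A) at `(E, 2)` ⊕ ONE factor of `2`.
Flag for the referee (reading audit wanted, lit-kato format):
`Kato-12.5(3)-14.14-14.16-at-two-negDisc-irreducible-fineSelmer-fg-plus-one`.

## Setting and notation at `p = 2`

`E/ℚ` NON-CM (Kato's §13; his CM proofs, §15, rest on Rubin's elliptic units and are not read at
`p = 2` here), globally minimal model `W`, Néron differential `ω = ω_E`, real period
`Ω_E = ∫_{E(ℝ)} |ω|` = the tree's `W.realPeriodRat`), with ADDITIVE, POTENTIALLY GOOD reduction at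
`2` (`ord₂ j(E) ≥ 0`), `E[2]` IRREDUCIBLE (no rational `2`-torsion; then `E(K)[2] = 0` for every
field `K` in which `ℚ(E[2])`, of degree `3` or `6`, does not embed — in particular for every layer
`ℚ_m = ℚ(ζ_{2^{m+2}})⁺` of the cyclotomic `ℤ₂`-extension `ℚ^cyc` and for `ℚ(ζ_{2^∞})`), NEGATIVE
DISCRIMINANT `Δ_E < 0` (model-independent), `L(E,1) ≠ 0`, `Ш(E/ℚ)` finite. `T = T₂E ≅ T*(1)`
(Weil pairing), `V = T ⊗ ℚ`, `W = E[2^∞]`, `W_M = E[2^M]`. `c` = complex conjugation.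
`G_∞ = Gal(ℚ(ζ_{2^∞})/ℚ) ≅ ℤ₂^× = Δ × U`, `Δ = {±1} = ⟨c⟩`, `U = 1 + 4ℤ₂`; `Λ = ℤ₂[[G_∞]]` (Kato's
ring, NOT regular at `2`); `Λ' := ℤ₂[[Gal(ℚ^cyc/ℚ)]] ≅ ℤ₂[[X]]` (`X = γ − 1`, `γ ↔ 5`; a regular local
ring of dimension `2`, maximal ideal `(2, X)`). Kato's `𝐇^q(T) = lim_n H^q(ℤ[ζ_{2^n}, 1/2], T)` (12.2;
a `Λ`-module; as a `ℤ₂[[U]]`-module it is the Iwasawa cohomology of `T` over the `ℤ₂`-extension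
`ℚ(ζ_{2^∞})/ℚ(i)`), and `𝐇'^q(T) := lim_m H^q(ℤ_m[1/2], T)` over the (totally real) layers `ℚ_m` of
`ℚ^cyc`, with `res`/`cores` between the two towers (`ℚ_m(i) = ℚ(ζ_{2^{m+2}})`, degree `2`):
`cores ∘ res = 2`, `res ∘ cores = 1 + c`. `z = z_γ ∈ H¹(ℤ[1/2], V)` = the image of Kato's `z_γ^{(2)}`
(14.13.1) for `γ ∈ V_ℚ(f_E) = H¹(E(ℂ), ℚ)` with `γ⁺` a `ℤ₂`-basis of `T(−1)⁺ = H¹(E(ℂ), ℤ₂)^{c = 1}`;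
`z' := (cores z_{2^{m+2}})_m ∈ 𝐇'¹(T) ⊗ ℚ` its `ℚ^cyc`-tower shadow, with bottom class `z`.

## The ten steps (T1–T10); «verbatim» = Kato's printed proof applies word for word to the displayed objects

* **T1 (archimedean triviality — the lemma that makes `p = 2` behave).** If `Δ_E < 0` then `c` acts
  on `E[2] = {O, P₁, P₂, P₃}` with exactly one fixed non-zero point (one real root of the
  `2`-division cubic), so `E[2] ≅ 𝔽₂[C₂]` as a `C₂ = Gal(ℂ/ℝ)`-module, hence (Nakayama) `T ≅ ℤ₂[C₂]`,
  and `T`, `W`, `W_M`, `T*(1)`, `W*` are induced, i.e. COHOMOLOGICALLY TRIVIAL `C₂`-modules: all Tate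
  cohomology groups `Ĥ^q(ℝ, ·)` vanish, `H^q(ℝ, ·) = 0` for `q ≥ 1`. Consequences, for `K = ℚ` or any
  totally real `ℚ_m`: (a) `H^q(O_K[1/2], F) = ⊕_{v real} H^q(K_v, F) = 0` for `q ≥ 3` and these `F`
  (Milne, *ADT* I.4.10 (c) / II.2.9), so «the `2`-cohomological dimension of `Spec ℤ_m[1/2]` is `2`»
  holds FOR THESE COEFFICIENTS; (b) the Poitou–Tate sequences with archimedean terms (Milne *ADT*
  I.4.10, exact for every `p` when the real places carry Tate cohomology) have all archimedean terms
  `0`, so Kato's (14.9.1)–(14.9.4) are EXACT at `p = 2` for `T` (Kato's «upto ×2» is the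
  archimedean defect, absent here); (c) the Selmer condition at `∞` (`H¹(ℝ, W) = 0`) is vacuous.
  [For `Δ_E > 0` one has `T ≅ ℤ₂ ⊕ ℤ₂(sgn)`, `H^q(ℝ, T) = ℤ/2` for all `q ≥ 1`, `H¹(ℝ, W) = ℤ/2`:
  NOT covered by this fact.]
* **T2 (12.4 for `Λ'`, verbatim 13.8).** `𝐇'¹(T)` is torsion-free (13.8: `x = 2` via
  `lim_m H⁰(ℚ_m, T/2) = 0` — the norm `ℚ_{m+1} → ℚ_m` is multiplication by `2` on the stabilised
  `H⁰`, here even `E(ℚ_m)[2] = 0`; `Λ'/x` `2`-torsion-free via irreducible non-abelian `V`) and FREE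
  of rank `1` over `Λ'` (13.8's regular-sequence argument for the maximal ideal `(x, y) = (2, X)` of
  the regular local ring `Λ'`: `y` is injective on `𝐇'¹/x𝐇'¹ ⊂ H¹(ℤ[1/2], T ⊗ Λ'/x)` because
  `H⁰(ℤ[1/2], T ⊗ Λ'/(x,y)) = H⁰(ℚ, E[2](r)) = 0` by irreducibility; depth `2` over a `2`-dimensional
  regular local ring ⇒ free; rank `1` from Tate's Euler characteristic (12.2.2)/(14.9.5) over `ℚ_m`,
  `rank 𝐇'¹ − rank 𝐇'² = rank T⁻ = 1`, and T3).
* **T3 (localisation lemma `Λ → Λ'`, elementary).** For a height-one prime `𝔮` of `Λ'` with `2 ∉ 𝔮`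
  (`2` is a unit in `Λ'_𝔮`): `Λ ⊗_{Λ'} Λ'_𝔮 = Λ'_𝔮 e₊ × Λ'_𝔮 e₋` (`e_± = (1 ± c)/2`), and `res`
  induces `(𝐇'^q)_𝔮 ≅ e₊(𝐇^q)_𝔮 = (𝐇^q)_{𝔭₊}` where `𝔭₊ ⊂ Λ` is the height-one prime over `𝔮` on
  which `c = +1` (`cores∘res = 2` invertible ⇒ `res` injective, `res∘cores = 2e₊` ⇒ image `= e₊`);
  likewise `(Λ'z')_𝔮 ≅ (Λ z_γ)_{𝔭₊}` and `(𝐇'¹/Λ'z')_𝔮 ≅ e₊(𝐇¹/Λ z_γ)_𝔮`; `𝔭₊ ∌ 2` is one of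
  Kato's «prime ideals of `Λ` of height one which do not contain `p`». Hence, from Kato's printed
  all-`p` statements — Thm. 12.4 (1) [`𝐇²(T)` torsion; tree `Kato2004_fineSelmerDual_isTorsion`,
  every `p`], Thm. 12.5 (2)(3) [13.13: «consequence of the inequality in Thm. 13.4 (2)», which at
  `p = 2` is Kato, Kodai Math. J. 22 (1999) Thm. 0.8 for `𝔭 ∌ p`, parity-free — tree audit
  `KatoRankBound.lean` § `KatoRankBoundAllPrimes`], and 14.13 [`𝐇²(V)_𝔭 = 0`, `(𝐇¹(V)/Z(f))_𝔭 = 0`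
  at the augmentation prime from `L(E,1) ≠ 0` via `exp*`, Thm. 12.5 (1)]: `𝐇'²(T)` is
  `Λ'`-torsion; for EVERY height-one `𝔮 ∌ 2` of `Λ'`,
  `length_𝔮(𝐇'²_𝔮) ≤ length_𝔮((𝐇'¹/Λ'z')_𝔮)` (the local term `𝐇²_loc` of 12.5 (3) is `0` at a
  potentially good `p`, (12.5.1)); and `𝐇'²_{(X)} = 0`, `(𝐇'¹/Λ'z')_{(X)} = 0`.
* **T4 (the `μ`-part = statement (A), HYPOTHESIS).** At the one height-one prime `(2)` of `Λ'`
  nothing is printed at `p = 2` (Thm. 13.4 (3): «Assume further `p ≠ 2`»; Conj. 12.10: «In the case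
  `p = 2`, assume `𝔭` does not contain `2`»). The hypothesis `hA` — the Pontryagin dual `Y(E/ℚ^cyc)`
  of the fine Selmer group `Sel₀(ℚ^cyc, E[2^∞])` is a finitely generated `ℤ₂`-module, Coates–Sujatha's
  statement (A) at `(E, 2)` [CoatesSujatha2005] in the tree's `∃ γ D` spelling over
  `WeierstrassCurve.FineSelmerDualData` (file `KatoFineSelmerDual.lean`) — is EQUIVALENT to
  «`𝐇'²(T)` is a finitely generated `ℤ₂`-module» (Lim 2017 §3 lemma: Poitou–Tate over the `ℚ_m`,
  exact by T1, the local terms `⊕_{w ∣ v ∈ S} E[2^∞](ℚ^cyc_w)` being `ℤ₂`-cofinitely generated; Kato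
  8.2/12.2 + Leray for the comparison of `j_*`-cohomology with `H²(G_S)`, as in the sibling's item 8),
  hence gives `length_{(2)}(𝐇'²_{(2)}) = 0`, i.e. `μ(𝐇'²(T)) = 0`.
* **T5 (integrality of the zeta element, 12.6 + T2 + an elementary remark).** Thm. 12.6 (stated for
  every `p`, T `= V_{O_λ}(f)`; with `E[2]` irreducible all stable lattices are `2^k T₂E`, Remark 12.8,
  and the statement «`z_γ ∈ 𝐇'¹(T)` for `γ⁺` a basis of `T(−1)⁺`» is homothety-invariant): the
  `Λ`-span `Z` of the INTEGRAL elements `_{c,d} z_{2^n}^{(2)}(f,k,j,a,…) ∈ 𝐇¹(T)` (§8) has finite index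
  in `Z(f,T) ∋ z_γ`. So `cores Z ⊂ 𝐇'¹(T)` and `(Λ' z' + 𝐇'¹)/𝐇'¹ ⊂ (𝐇'¹ ⊗ ℚ)/𝐇'¹` is a FINITE
  `Λ'`-module; but `𝐇'¹ ≅ Λ'` (T2) and `(Λ' ⊗ ℚ)/Λ'` has no non-zero element killed by a power of
  `(2, X)` (`ℤ₂[[X]]` is a UFD in which `2` and `X` are coprime primes: `X·a ∈ 2^kΛ' ⇒ a ∈ 2^kΛ'`);
  hence `z' ∈ 𝐇'¹(T)`: writing `𝐇'¹ = Λ' b`, `z' = φ b` with `φ ∈ Λ'`, `φ(0) ≠ 0` (T3), and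
  `m := μ(φ) ≥ 0` (the `2`-adic content exponent of `φ`).
* **T6 (descent 14.14 over `Λ'`, `a = X`, verbatim + Lemma 14.15 with `A = Λ'`).** By T1 (a),
  `𝐇'^q = 0` for `q ≥ 3` and `H⁰(ℤ[1/2], T) = 0`, so «the argument as in 13.8» (the `Tor`-spectral
  sequence of `RΓ(ℤ[1/2], T ⊗ Λ') ⊗^𝐋 Λ'/X ≅ RΓ(ℤ[1/2], T)`) gives Kato's (14.14.1)
  `0 → 𝐇'¹/X → H¹(ℤ[1/2], T) → 𝐇'²[X] → 0` and (14.14.2) `𝐇'²/X ≅ H²(ℤ[1/2], T)`. Let `(g)`,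
  `g = 2^{μ₂} g₀` (`μ₂ = μ(𝐇'²)`, `g₀` of content `0`), be the characteristic ideal of the torsion
  module `𝐇'²`, and `φ = 2^m φ₀`. T3 ⇒ `g₀ ∣ φ₀`; T3 at `(X)` ⇒ `g(0) φ(0) ≠ 0`; Lemma 14.15 (any
  Noetherian `A`; here the Euler-characteristic identity `#(M/XM)/#(M[X]) = |char_M(0)|₂⁻¹` for
  torsion `M` with `char_M(0) ≠ 0`) ⇒ `#H²(ℤ[1/2],T) = #(𝐇'²/X) = 2^{μ₂}|g₀(0)|₂⁻¹·#𝐇'²[X]`, while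
  (14.14.1) with `𝐇'¹/X = ℤ₂ b̄ ↪ H¹(ℤ[1/2],T)` and `z = φ(0) b̄` gives, in Kato's `[M : z]` notation
  (p. 237), `[H¹(ℤ[1/2],T) : z] = |φ(0)|₂⁻¹·#𝐇'²[X] = 2^m |φ₀(0)|₂⁻¹·#𝐇'²[X]`. Therefore
  `#H²(ℤ[1/2], T) ≤ 2^{μ₂ − m} · [H¹(ℤ[1/2], T) : z]`, and with T4 (`μ₂ = 0`) and T5 (`m ≥ 0`):
  `#H²(ℤ[1/2], T) ≤ [H¹(ℤ[1/2], T) : z]` — Kato's Thm. 14.5 (3) conclusion at `p = 2` for this `T`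
  (his `μ ≥ 1`).
* **T7 (Prop. 14.16 (2) verbatim).** By T1 (a)(b) Kato's proof of 14.16 (pp. 244–245) applies word
  for word: `#S(T) = μ⁻¹ · ν · #H⁰(ℚ, W) · #H⁰(ℚ, W*) = μ⁻¹ ν ≤ ν` (both `H⁰` are `E(ℚ)[2^∞] = 0`),
  `ν = [H¹(ℚ₂,T)/H¹_f(ℚ₂,T) : z] · #H²(ℚ₂,T)⁻¹`.
* **T8 (the local index at an ADDITIVE `2`, replacing Kim's Lemma 3.10; elementary).** `H¹_f(ℚ₂, T)`
  (preimage of `H¹_f(ℚ₂, V)`) is the Kummer image of `E(ℚ₂) ⊗ ℤ₂ ≅ ℤ₂ × E(ℚ₂)[2^∞]`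
  (Bloch–Kato Ex. 3.11), so `H¹(ℚ₂,T)/H¹_f` is torsion-free of rank `1` and `exp*_ω` maps it
  isomorphically onto `exp*_ω(H¹(ℚ₂, T)) ⊂ ℚ₂`. Let `log_ω : E(ℚ₂) → ℚ₂` be the formal logarithm
  (kernel = torsion) and `2^a ℤ₂ := log_ω(E(ℚ₂))` (`a ∈ ℤ`). CLAIM: `exp*_ω(H¹(ℚ₂, T)) = 2^{−a} ℤ₂`
  and `a = t − v₂(c₂)`, `2^t = #E(ℚ₂)[2^∞]`, `c₂ = [E(ℚ₂) : E₀(ℚ₂)]`; hence, with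
  `#H²(ℚ₂, T) = #H⁰(ℚ₂, W) = 2^t` (local duality, `T*(1) ≅ T`),
  `ν = 2^{ord₂(exp*_ω z) + a − t} = |exp*_ω(z)|₂⁻¹ · |c₂|₂` — the SAME shape as at odd additive `p`
  (the sibling's «`ν = |L(E,1)/Ω_E|_p⁻¹ · |c_p|_p` in general»). Proof of the claim: (i) the cup
  product `H¹(ℚ₂,T) × H¹(ℚ₂,T) → H²(ℚ₂, ℤ₂(1)) = ℤ₂` is `ℤ₂`-valued and satisfies
  `⟨x, κ(P)⟩ = exp*_ω(x) · log_ω(P)` (Bloch–Kato §3 / Kato Ch. II §1: `exp*` is the transpose of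
  `exp = κ ∘ exp_E`), so `exp*_ω(H¹(ℚ₂,T)) · 2^aℤ₂ ⊂ ℤ₂`; (ii) conversely
  `H¹(ℚ₂,T) ≅ H¹(ℚ₂,W)^∨ ↠ (E(ℚ₂) ⊗ ℚ₂/ℤ₂)^∨ = Hom(E(ℚ₂) ⊗ ℤ₂ / tors, ℤ₂)` (Tate local duality is
  perfect; the dual of the Kummer injection is surjective), so every `ℤ₂`-linear functional on
  `log_ω(E(ℚ₂)) = 2^aℤ₂` is an `exp*_ω(x)·(−)`: `exp*_ω(H¹(ℚ₂,T)) = 2^{−a}ℤ₂`; (iii)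
  `a = t − v₂(c₂)`: with `U = Ê(4ℤ₂) ⊂ E(ℚ₂)` (on which `log_ω` is a measure-preserving bijection
  onto `4ℤ₂`, Silverman *AEC* IV.6.4 with `r = 2 > v(2)/(2−1)`, and `μ_ω(U) = 1/4`), Tate's
  measure computation `μ_ω(E(ℚ₂)) = c₂ · #Ẽ_ns(𝔽₂)/2 = c₂` (additive: `Ẽ_ns ≅ 𝔾_a`, two points) and
  `μ_ω(E(ℚ₂)) = [E(ℚ₂) : U]·μ_ω(U) = #E(ℚ₂)_tors · [2^aℤ₂ : 4ℤ₂] · ¼ = #E(ℚ₂)_tors · 2^{−a}` give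
  `2^{−a} = c₂ / #E(ℚ₂)_tors` (the odd parts agree: the prime-to-`2` torsion of `E(ℚ₂)` maps
  isomorphically onto the prime-to-`2` part of `E(ℚ₂)/E₁(ℚ₂)`, of order the odd part of `2c₂`).
* **T9 (the period at `p = 2`, Thm. 12.5 (1) verbatim + a computation).** 12.5 (1) (every `p`;
  `L_{(2)}(E,1) = L(E,1)` at an additive `2`) gives `exp*(z) = (L(E,1)/Ω⁺_γ)·ω_E` with
  `[ω_E] = Ω⁺_γ γ⁺ + Ω⁻_γ γ⁻` in `H¹(E(ℂ), ℂ)`, `γ^±` bases of `H¹(E(ℂ),ℤ₂)^{c = ±1}` (taking `γ`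
  and `ω` both on `E`, the Manin constant of the parametrisation cancels, exactly as in the sibling;
  the same vestigial Manin hypothesis is NOT carried here — the sibling carries it only for
  uniformity with Kim's normalisation, which this file does not use). COMPUTATION (`Δ_E < 0`; period
  lattice `ℤω₁ ⊕ ℤω₂`, `ω₁ = Ω_E > 0` real — `E(ℝ)` is connected —, `ω̄₂ = ω₁ − ω₂`; on
  `H¹ = Hom(H₁, ℤ)` with coordinates `(φ(ω₁), φ(ω₂))`: `(H¹)⁺ = ℤ·(2,1)`, `(H¹)⁻ = ℤ·(0,1)`,
  `[ω_E] = (ω₁, ω₂) = (ω₁/2)·(2,1) + (ω₂ − ω₁/2)·(0,1)`): `Ω⁺_γ = Ω_E/2` (up to `ℤ₂^×`). [For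
  `Δ_E > 0`: `(H¹)⁺ = ℤ·(1,0)`, `Ω⁺_γ = ω₁ = Ω_E/2` as well, `Ω_E = 2ω₁`.] Hence
  `exp*_ω(z) = 2·L(E,1)/Ω_E · u`, `u ∈ ℤ₂^×`, and `ν = 2^{1 + ord₂(L(E,1)/Ω_E) − v₂(c₂)}` — THIS is
  the displayed `+ 1`. (The Tamagawa number conjecture predicts `μ = 2` here, i.e. that the `+ 1` is
  an artefact of normalising `γ` in cohomology; nothing of the kind is claimed or used.)
* **T10 (from `S(T)` to `Ш`, verbatim as the sibling's items 4–5).** `S(T) = {x ∈ H¹(G_S, W) :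
  loc_ℓ x ∈ H¹_ur(ℚ_ℓ, W) (ℓ ∣ N, ℓ ≠ 2), loc₂ x ∈ H¹_f}` (Leray for `j_*`, Kato 8.2/§14.8) contains
  `Sel(T) = Ш(E/ℚ)[2^∞]` (rank `0`, `E(ℚ) ⊗ ℚ₂/ℤ₂ = 0`; the condition at `∞` is vacuous by T1 (c))
  with `S(T)/Sel(T) ≅ ⊕_{ℓ ∣ N, ℓ ≠ 2} H¹_ur(ℚ_ℓ,W)/H¹_f(ℚ_ℓ,W)`, each of order
  `#H¹(𝔽_ℓ, Φ_ℓ[2^∞]) = #Φ_ℓ(𝔽_ℓ)[2^∞] = |c_ℓ|₂⁻¹` (surjectivity: Cassels–Poitou–Tate / Greenberg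
  LNM 1716 Prop. 4.13 with `E(ℚ)[2] = 0` and the compact Selmer group of `T` equal to `0` in rank `0`;
  exact by T1 (b)). TOTAL: `ord₂ #Ш(E/ℚ)[2^∞] + Σ_{ℓ≠2} v₂(c_ℓ) = log₂ #S(T) ≤ log₂ ν
  = 1 + ord₂(L(E,1)/Ω_E) − v₂(c₂)`, i.e. the statement typed below.

WHAT IS NOT CLAIMED. Statement (A) is NOT asserted (hypothesis); nothing for `Δ_E > 0` (T1), for
reducible `E[2]` (T2, T5), at a potentially multiplicative `2` (12.5.1), in analytic rank `1`, or
about the removability of the `+ 1` (T9); no lower bound. The non-verbatim steps are T1, T3, T5's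
closing remark, T8 and the computation in T9 — each an elementary lemma written out above; the
verbatim steps are Kato's own proofs 13.8, 13.13–13.14, 14.13–14.16 applied to `Λ'`, `𝐇'^q`, `z'`
and `T = T₂E` with `Δ_E < 0`. Derivation memo with the same numbering:
`run/shared/lean/pub/bsd-2adic/addL2x/VERDICT-19098-addL2x-GEN5.md`.

THE LEAN STATEMENT AND ITS NORMALISATION. Exactly the sibling's (`W` globally minimal,
`Ω(W) = W.realPeriodRat`, additive = `¬ good ∧ ¬ multiplicative`, potentially good = `0 ≤ ord₂ j(W)`,
`E[2]` irreducible = `W.HasIrreducibleModPGaloisRep 2`, statement (A) at `(E,2)` = the `∃ γ D`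
finite-generation hypothesis over every cyclotomic `κ : ZpExtension ℚ 2`, `Ш` finite = `Finite W.sha`)
with `p = 2` fixed, the extra hypothesis `W.Δ < 0`, and the conclusion weakened by `+ 1`:
there is `q ∈ ℚ` with `L(E,1)/Ω(W) = q` and `ord₂ #Ш(E/ℚ)(2) + v₂(Tam(W)) ≤ ord₂ q + 1`. Weaker than
what the printed arguments give at odd `p`; never stronger; no `_holds` (size XL).

## References

* K. Kato, Astérisque 295 (2004): 8.2 (pp. 180–181), 12.1–12.2 incl. (12.1.4), (12.2.1)–(12.2.2)
  (pp. 219–220), Thm. 12.4 (p. 221), Thm. 12.5 (1)–(4), (12.5.1), (12.5.2) (p. 222), Thm. 12.6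
  (p. 222), Remark 12.8 (p. 223), Conj. 12.10 (p. 224), Thm. 13.4 (p. 226), 13.7–13.8
  (pp. 227–229), 13.12–13.14 (pp. 231–234), §14.1 (pp. 234–235), Thm. 14.5 and `[M : z]`
  (pp. 236–237), §14.8 (p. 238), (14.9.1)–(14.9.6) incl. «exact upto ×2 in the case p = 2»
  (pp. 239–240), 14.13–14.14, Lemma 14.15 (pp. 242–244), Prop. 14.16 and its proof (pp. 244–245),
  17.13 (p. 279). [Kato2004Asterisque]
* K. Kato, Kodai Math. J. 22 (1999) 313–372, Thm. 0.8 (p. 318), Prop. 10.5 (4) (p. 356), p. 364.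
  [Kato1999Kodai]
* K. Rubin, *Euler Systems*, Ann. of Math. Stud. 147 (2000) = AWS 1999 notes, Ch. II Thm. 2.3
  («holds even if p = 2»), Thms. 3.2–3.4, Ch. III p. 37 («Theorem II.3.3 also applies when p = 2»),
  Ch. V §3 («We now allow p = 2»). [Rubin2000]
* J. Coates, R. Sujatha, Math. Ann. 331 (2005) 809–839, statement (A). [CoatesSujatha2005]
* M. F. Lim, Asian J. Math. 21 (2017) 337–362 = arXiv:1306.2047, §2–§3. [Lim2017FineSelmer]
* S. Bloch, K. Kato, in *The Grothendieck Festschrift* I (1990), §3 (Def. 3.10, Ex. 3.11, Prop. 3.8). [BlochKato1990]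
* J. S. Milne, *Arithmetic Duality Theorems* (2nd ed. 2006), I.4.10, II.2.9. [MilneADT2006]
* J. H. Silverman, *AEC* (2nd ed.), IV.6.4, VII.2, Thm. X.4.14; J. Tate, «Algorithm for determining
  the type of a singular fiber», LNM 476 (1975) §1 (the measure `μ_ω(E(ℚ_p)) = c_p·#Ẽ_ns(𝔽_p)/p`).
  [SilvermanAEC2009] [Tate1975]
* R. Greenberg, LNM 1716 (1999), Prop. 4.13; §3 after Lemma 3.3. [GreenbergLNM1716]
-/

noncomputable section

open scoped Classical

namespace Literature.NumberTheory.EllipticCurves.Kato2004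

open WeierstrassCurve

/-- **Kato's Euler-system bound at an additive, potentially good prime `2`, in analytic rank `0`,
for IRREDUCIBLE `E[2]` and NEGATIVE discriminant, GRANTED the finite generation over `ℤ₂` of the dual
fine Selmer group `Y(E/ℚ^cyc)` (Coates–Sujatha's statement (A) at `(E, 2)`, a HYPOTHESIS here):
`ord₂ #Ш(E/ℚ)[2^∞] + v₂(∏_ℓ c_ℓ) ≤ ord₂(L(E,1)/Ω_E) + 1`.** A READING at `p = 2` of K. Kato,
Astérisque 295 (2004): the `λ`-part divisibility **Thm. 12.5 (3)** (p. 222, image-free, at every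
height-one prime not containing `p`; at `p = 2` via Kato 1999 Thm. 0.8) transferred to the
`ℚ^cyc`-tower ring `Λ' = ℤ₂[[X]]` by localisation (T3), freeness of `𝐇'¹` by the proof **13.8** of
Thm. 12.4 (3) run over the regular ring `Λ'` (T2), integrality of `z_γ` from **Thm. 12.6** (T5), the
`μ`-part from the HYPOTHESIS (A) at `(E,2)` via Lim 2017 §3 (T4), the descent **14.14 + Lemma 14.15**
with `a = X` (T6), **Prop. 14.16 (2)** (T7) — Kato's proofs of 14.14/14.16 applying VERBATIM because
for `Δ_E < 0` the Galois module `T₂E` is cohomologically trivial at `ℝ`, so `Spec ℤ_m[1/2]` has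
`2`-cohomological dimension `2` for these coefficients and Kato's sequences (14.9.1)–(14.9.4) are
exact (T1) —, the local index at the additive `2` by local Tate duality and the measure
`μ_ω(E(ℚ₂)) = c₂` (T8: `exp*_ω(H¹(ℚ₂,T)) = 2^{−a}ℤ₂`, `2^{−a} = c₂/#E(ℚ₂)_tors`), and **Thm. 12.5 (1)**
with the period computation `Ω⁺_γ = Ω_E/2` for `γ⁺` a basis of `H¹(E(ℂ),ℤ₂)⁺` (T9 — the source of
the displayed `+ 1`), assembled over `S(T) ⊇ Ш[2^∞]` with the Tamagawa quotients at `ℓ ≠ 2` (T10,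
Greenberg Prop. 4.13). See the module docstring, T1–T10, for every statement used and every
non-verbatim step written out. Let `W/ℚ` be a globally minimal NON-CM elliptic curve (Kato's §13 proofs;
the CM case, §15, is not read here) with ADDITIVE and
POTENTIALLY GOOD reduction at `2` (`0 ≤ ord₂ j(W)`), negative discriminant, `E[2]` irreducible,
`L(E,1) ≠ 0`, `Ш(E/ℚ)` finite, and assume (`hA`) that for every cyclotomic `ℤ₂`-extension datum `κ`
of `ℚ` some Pontryagin-dual datum `D` of `Sel₀(ℚ^cyc, E[2^∞])` (`W.FineSelmerDualData κ γ`) has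
`ℤ₂`-finitely generated underlying module. Then there is `q ∈ ℚ` with `L(E,1)/Ω(W) = q` and
`ord₂ #Ш(E/ℚ)(2) + v₂(Tam(W)) ≤ ord₂ q + 1`. Weaker than what the same arguments print at odd `p`
(the sibling fact, without `+ 1`); never stronger; no `_holds` (size XL). Flag for the referee:
`Kato-12.5(3)-14.14-14.16-at-two-negDisc-irreducible-fineSelmer-fg-plus-one`.
[cite: Kato2004Asterisque, Thm. 12.4 (p. 221), Thm. 12.5 (1)(3) and (12.5.1) (p. 222), Thm. 12.6 (p. 222), Remark 12.8 (p. 223), Conj. 12.10 (p. 224), Thm. 13.4 (2) (p. 226), 13.8 (pp. 227–229), 13.13–13.14 (pp. 233–234), 14.13–14.14 and Lemma 14.15 (pp. 242–244), Prop. 14.16 (2) and its proof (pp. 244–245), (14.9.1)–(14.9.5) (pp. 239–240), §14.8 (p. 238)]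
[cite: Kato1999Kodai, Thm. 0.8 (p. 318), Prop. 10.5 (4) (p. 356)]
[cite: Rubin2000, Ch. II Thm. 2.3 and Thms. 3.2–3.4; Ch. V §3]
[cite: Lim2017FineSelmer, §3 (the lemma «Y_S(T/F^cyc) f.g. over R iff H²_S(F^cyc/F,T) f.g. over R»)]
[cite: CoatesSujatha2005, statement (A) (introduction and §3)]
[cite: BlochKato1990, §3 Def. 3.10, Ex. 3.11, Prop. 3.8]
[cite: MilneADT2006, I.4.10, II.2.9]
[cite: SilvermanAEC2009, IV.6.4, Thm. X.4.14] [cite: Tate1975, §1]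
[cite: GreenbergLNM1716, Prop. 4.13; §3 after Lemma 3.3] -/
def rankZero_padicValNat_sha_add_padicValNat_tamagawa_le_add_one_at_two_of_negDisc_of_irreducible_of_fineSelmerDual_fg :
    Prop :=
  ∀ (W : WeierstrassCurve ℚ) [W.IsElliptic] [W.IsGloballyMinimal], ¬ W.HasCM →
    ¬ W.HasGoodReductionAtPrime 2 → ¬ W.HasMultiplicativeReductionAtPrime 2 →
    0 ≤ padicValRat 2 W.j →
    W.Δ < 0 →
    W.HasIrreducibleModPGaloisRep 2 →
    (∀ (κ : ZpExtension ℚ 2), κ.IsCyclotomic →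
      ∃ (γ : Field.absoluteGaloisGroup ℚ) (D : W.FineSelmerDualData κ γ),
        Module.Finite ℤ_[2] (RestrictScalars ℤ_[2] (IwasawaAlgebra 2) D.X)) →
    W.entireLFunction 1 ≠ 0 → Finite W.sha →
    ∃ q : ℚ, W.entireLFunction 1 / (W.realPeriodRat : ℂ) = (q : ℂ) ∧
      (padicValNat 2 (Nat.card (AddCommGroup.primaryComponent W.sha 2)) : ℤ) +
          padicValNat 2 W.tamagawaProduct ≤ padicValRat 2 q + 1

end Literature.NumberTheory.EllipticCurves.Kato2004


/-! ## APPEND (same seat, same GEN, 2026-08-27): the reading WITHOUT the sign hypothesis on the discriminant — the archimedean bookkeeping at `p = 2` for `Δ_E > 0` (`T₂E ≅ ℤ₂ ⊕ ℤ₂(sgn)` at `ℝ`)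

WHY. The fact above keeps Kato's own proofs of 14.14 / 14.16 verbatim by restricting to `Δ_E < 0`, where every
archimedean cohomology group of `T₂E` vanishes (T1). For `Δ_E > 0` (all of `E[2]` real; on the seat's block ≈ 27 % of the
classes, kit j289186) `c` acts on `T = T₂E` as `diag(1, −1)`: `T ≅ ℤ₂ ⊕ ℤ₂(sgn)`, `H^q(ℝ, T) = ℤ/2` for every `q ≥ 1`,
`H¹(ℝ, W) = ℤ/2`, and the real places of the totally real layers `ℚ_m` contribute
`𝐇'^q(T) := lim_m H^q(ℤ_m[1/2], T) ≅ 𝔽₂[[X]]` for `q ≥ 3` and a quotient `𝐇'²(T) ↠ 𝔽₂[[X]]`. This append records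
that the SAME inequality `ord₂ #Ш + v₂(Tam) ≤ ord₂(L(E,1)/Ω_E) + 1` follows for either sign of `Δ_E`, when the two
places where Kato uses «`p`-cohomological dimension `2`» / the archimedean-free sequences (14.9.3)–(14.9.4) are run with
the archimedean terms INSERTED (Poitou–Tate with the real place in the set of places is exact for `p = 2`: Milne, *ADT*
I.4.10 — only the `H⁰`-terms need Tate's modification, and no `H⁰`-term enters below; Rubin, *Euler Systems* Ch. I §§3–7
treats «`K_v = ℝ` and `p = 2`» explicitly). Steps T2, T3, T5, T8, T9, T10 of the fact above are archimedean-free and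
are used word for word; T1, T4, T6, T7 are replaced by T1′, T4′, T6′, T7′:

* **T1′ (archimedean structure).** `r_∞ := 1` if `Δ_E > 0`, `0` if `Δ_E < 0`. Then `#H^q(ℝ, T) = 2^{r_∞}` (`q ≥ 1`),
  `#H¹(ℝ, W) = 2^{r_∞}`, `H¹(ℝ, T)/H¹_f(ℝ, T) = 0` (Bloch–Kato: `H¹_f(ℝ, V) = H¹(ℝ, V) = 0`, so `H¹_f(ℝ,T)` = everything and
  `H¹_f(ℝ, W) = 0` — exact annihilators under the perfect pairing `H¹(ℝ,T) × H¹(ℝ,W) → ℤ/2`), and, the real places of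
  `ℚ_m` being a torsor under `Gal(ℚ_m/ℚ)` (decomposition groups at real places of a totally real Galois field are
  trivial), `lim_m ⊕_{v ∣ ∞} H^q(ℚ_{m,v}, T) ≅ (Λ'/2Λ')^{r_∞} = 𝔽₂[[X]]^{r_∞}` with `cores` = the projections of
  `𝔽₂[Gal(ℚ_m/ℚ)]`; in particular `𝐇'^q(T) ≅ 𝔽₂[[X]]^{r_∞}` for `q ≥ 3` (`H^q(ℤ_m[1/2], T) = ⊕_{v real} H^q(ℝ,T)`
  for `q ≥ 3`), which is `X`-TORSION-FREE.
* **T2–T3, T5 unchanged** (13.8's regular-sequence proof uses only `𝐇'¹/x ↪ H¹(ℤ[1/2], T ⊗ Λ'/x)` from the long exact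
  sequence and `H⁰(ℚ, E[2]) = 0`, no cohomological dimension; the rank count `rank 𝐇'¹ − rank 𝐇'² = rank T⁻ = 1` is
  Tate's global Euler characteristic over the totally real `ℚ_m`, `χ = Σ_{v∣∞} rank H⁰(ℝ,T) − [ℚ_m:ℚ]·rank T`; T3's
  vanishing `𝐇'²_{(X)} = 0` needs only the finiteness of `H²(ℤ[1/2],T)`, i.e. of `Sel^{str}(W)` below — rank `0`).
* **T4′ (`μ(𝐇'²) = r_∞` under (A)).** Poitou–Tate at each level `m` (exact, archimedean terms included):
  `0 → Sel^{str}(W/ℚ_m)^∨ → H²(ℤ_m[1/2], T) → ⊕_{v ∈ {2-adic, real}} H²(ℚ_{m,v}, T) → E(ℚ_m)[2^∞]^∨ = 0`, where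
  `Sel^{str}` = classes in `H¹(G_S, W)` that are `0` at the places above `2` and `∞` and unramified at `ℓ ∣ N` (the
  `j_*`-condition, Leray, Kato 8.2); in the limit `0 → Y^{str} → 𝐇'²(T) → ⊕_{w∣2} H⁰(ℚ^cyc_w, W)^∨ ⊕ 𝔽₂[[X]]^{r_∞} → 0`.
  `Y^{str}` and the dual fine Selmer group `Y(E/ℚ^cyc)` (strict at EVERY place of `S`) differ by the Pontryagin dual of
  `⊕_{w ∣ ℓ ∣ N} H¹_ur(ℚ^cyc_w, W)` — finitely many `w`, each term `ℤ₂`-cofinitely generated — and the `2`-adic local term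
  is `ℤ₂`-finitely generated; hence under (A): `μ(𝐇'²(T)) = μ(𝔽₂[[X]]^{r_∞}) = r_∞`.
* **T6′ (descent).** As in T6 (the `Tor`-spectral sequence needs `𝐇'³[X] = 0`, which is T1′, and `H⁰(ℤ[1/2],T) = 0`):
  `0 → 𝐇'¹/X → H¹(ℤ[1/2],T) → 𝐇'²[X] → 0`, `𝐇'²/X ≅ H²(ℤ[1/2],T)`, and with `char(𝐇'²) = (2^{r_∞} g₀)`, `z' = 2^m φ₀ b`,
  `g₀ ∣ φ₀`, `m ≥ 0` (T5): `(★★) #H²(ℤ[1/2], T) ≤ 2^{r_∞ − m} · [H¹(ℤ[1/2], T) : z] ≤ 2^{r_∞} · [H¹(ℤ[1/2], T) : z]`.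
* **T7′ (the count, replacing 14.16; Poitou–Tate for Selmer structures, Rubin Thm. I.7.3 / Mazur–Rubin Thm. 2.3.4,
  exact at `p = 2` with the real place in `Σ`).** Selmer structures on `T` over `Σ = {2, ∞} ∪ {ℓ ∣ N}`: `G` = (all at `2`,
  all at `∞`, `H¹_ur` at `ℓ`) so that `H¹_G(ℚ,T) = H¹(ℤ[1/2], T)` (Kato's, T10); `F` = (Bloch–Kato `H¹_f` at `2`,
  `H¹_f = H¹` at `∞`, `H¹_ur` at `ℓ`); duals on `W`: `G*` = (`0` at `2`, `0` at `∞`, `H¹_ur` at `ℓ`) with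
  `H¹_{G*}(ℚ,W) = Sel^{str}(W)`, and `F*` = (`H¹_f` at `2`, `0` at `∞`, `H¹_ur` at `ℓ`) with `H¹_{F*}(ℚ,W) =: S₁(W)` (the
  unramified classes at `ℓ ∣ N` are exact annihilators of each other, Milne *ADT* I.2.6 with `#H¹_ur(M)·#H¹_ur(M') =
  #H¹(ℚ_ℓ,M)` for `ℓ ∤ #M`). The sequence `0 → H¹_F(ℚ,T) → H¹_G(ℚ,T) → ⊕_{v∈Σ} G_v/F_v → H¹_{F*}(ℚ,W)^∨ →
  H¹_{G*}(ℚ,W)^∨ → 0` reads, with `H¹_F(ℚ,T) = 0` (torsion-free of rank `rank E(ℚ) = 0`), `G_∞/F_∞ = 0`, `G_ℓ = F_ℓ`: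
  `0 → H¹(ℤ[1/2],T) →loc_s H¹_s(ℚ₂,T) → S₁(W)^∨ → Sel^{str}(W)^∨ → 0`; and the `H²`-segment of the same duality
  (Kato's (14.9.3) with the real place inserted) gives `#H²(ℤ[1/2],T) = #Sel^{str}(W) · #H²(ℚ₂,T) · #H²(ℝ,T) =
  #Sel^{str}(W) · 2^{t + r_∞}` (`H⁰(ℚ,W) = 0`). Hence `[H¹(ℤ[1/2],T) : z] = [H¹_s(ℚ₂,T) : z] · #Sel^{str}(W)/#S₁(W)
  = 2^{a + e} · #Sel^{str}(W)/#S₁(W)` (`e := ord₂ exp*_ω(z)`, T8), and (★★) becomes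
  `#Sel^{str}(W) · 2^{t + r_∞} ≤ 2^{r_∞ − m} · 2^{a + e} · #Sel^{str}(W)/#S₁(W)`, i.e.
  `#S₁(W) ≤ 2^{a + e − t − m} = 2^{e − v₂(c₂) − m} ≤ 2^{1 + ord₂(L(E,1)/Ω_E) − v₂(c₂)}` (T8: `a = t − v₂(c₂)`; T9:
  `e = 1 + ord₂(L(E,1)/Ω_E)`; T5: `m ≥ 0`) — the factor `2^{r_∞}` of the real place CANCELS between `μ(𝐇'²)` and
  `#H²(ℝ,T)`. [For `Δ_E < 0` this re-derives the fact above without invoking 14.16.]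
* **T10 unchanged**: `S₁(W) ⊇ Ш(E/ℚ)[2^∞]` (the condition «`0` at `∞`» is part of the definition of `Ш`), index
  `∏_{ℓ ∣ N odd} |c_ℓ|₂⁻¹`. TOTAL: `ord₂ #Ш(E/ℚ)[2^∞] + Σ_ℓ v₂(c_ℓ) ≤ ord₂(L(E,1)/Ω_E) + 1` for either sign of `Δ_E`.

CONSISTENCY CHECK (not used): with BSD₂ the Tamagawa-number-conjecture quantity `μ = [H¹(ℤ[1/2],T):z]/#H²(ℤ[1/2],T)`
equals `2^{1 − r_∞}`: Kato's `γ`-normalised `z_γ` is TNC-optimal exactly when `E(ℝ)` has two components, and in both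
cases the displayed `+ 1` is the unproved divisibility «`2 ∣ z'` in `𝐇'¹(T)`» (`m = 1`), cf. T9.

WHAT IS NOT CLAIMED. As for the fact above; in addition the non-verbatim steps now include T1′, T4′, T6′'s use of
`𝐇'³[X] = 0`, and the whole of T7′ (a standard Poitou–Tate count, written out). Flag for the referee:
`Kato-12.5(3)-14.14-at-two-anyDisc-irreducible-fineSelmer-fg-plus-one` (audit separately from the `Δ < 0` fact: that one
is verbatim-14.16, this one is not).

References (beyond those of the fact above): K. Rubin, *Euler Systems*, Ch. I §3 (archimedean `H¹_f`), Thm. I.7.3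
(global duality for Selmer structures) [Rubin2000]; B. Mazur, K. Rubin, *Kolyvagin systems*, Mem. AMS 799 (2004),
Thm. 2.3.4 [MazurRubin2004]; J. S. Milne, *ADT* I.2.6, I.4.10 [MilneADT2006].
-/

namespace Literature.NumberTheory.EllipticCurves.Kato2004

open WeierstrassCurve

/-- **Kato's Euler-system bound at an additive, potentially good prime `2`, in analytic rank `0`, for IRREDUCIBLE `E[2]`
and EITHER SIGN of the discriminant, GRANTED Coates–Sujatha's statement (A) at `(E, 2)`:
`ord₂ #Ш(E/ℚ)[2^∞] + v₂(∏_ℓ c_ℓ) ≤ ord₂(L(E,1)/Ω_E) + 1`.** The `Δ`-free twin of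
`rankZero_padicValNat_sha_add_padicValNat_tamagawa_le_add_one_at_two_of_negDisc_of_irreducible_of_fineSelmerDual_fg`
(same file): Kato, Astérisque 295 (2004), **Thm. 12.5 (3)** at `2` via Kato 1999 Thm. 0.8 moved to `Λ' = ℤ₂[[X]]` (T3),
**13.8** over `Λ'` (T2), **Thm. 12.6** (T5), **14.14 + Lemma 14.15** with `a = X` (T6′, using `𝐇'³[X] = 0`: the real places
of the `ℚ_m` contribute `𝔽₂[[X]]`, which is `X`-torsion-free, T1′), the `μ`-part from the HYPOTHESIS (A) at `(E,2)` in the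
form `μ(𝐇'²(T)) = r_∞` (`r_∞ = 1` iff `Δ_E > 0`; T4′), the local index at the additive `2` (T8), the period
`Ω⁺_γ = Ω_E/2` via **Thm. 12.5 (1)** (T9), and — instead of Prop. 14.16 — the Poitou–Tate sequence for Selmer structures
with the real place inserted (Rubin Thm. I.7.3 / Mazur–Rubin Thm. 2.3.4; T7′), in which the archimedean factor `2^{r_∞}`
cancels against `#H²(ℝ, T₂E) = 2^{r_∞}`. See the APPEND module docstring (T1′, T4′, T6′, T7′) and the docstring of
the `Δ < 0` fact (T2, T3, T5, T8, T9, T10). Let `W/ℚ` be a globally minimal NON-CM elliptic curve with ADDITIVE and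
POTENTIALLY GOOD reduction at `2` (`0 ≤ ord₂ j(W)`), `E[2]` irreducible, `L(E,1) ≠ 0`, `Ш(E/ℚ)` finite, and assume
(`hA`) that for every cyclotomic `ℤ₂`-extension datum `κ` of `ℚ` some Pontryagin-dual datum `D` of
`Sel₀(ℚ^cyc, E[2^∞])` has `ℤ₂`-finitely generated underlying module. Then there is `q ∈ ℚ` with `L(E,1)/Ω(W) = q` and
`ord₂ #Ш(E/ℚ)(2) + v₂(Tam(W)) ≤ ord₂ q + 1`. A READING (non-verbatim steps T1′, T3, T4′, T5, T6′, T7′, T8, T9 written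
out); never stronger than what the arguments give; no `_holds` (size XL). Flag for the referee:
`Kato-12.5(3)-14.14-at-two-anyDisc-irreducible-fineSelmer-fg-plus-one`.
[cite: Kato2004Asterisque, Thm. 12.4 (p. 221), Thm. 12.5 (1)(3) and (12.5.1) (p. 222), Thm. 12.6 (p. 222), Remark 12.8 (p. 223), Thm. 13.4 (2) (p. 226), 13.8 (pp. 227–229), 13.13–13.14 (pp. 233–234), 14.13–14.14 and Lemma 14.15 (pp. 242–244), (14.9.1)–(14.9.5) (pp. 239–240), 8.2 (pp. 180–181), §14.8 (p. 238)]
[cite: Kato1999Kodai, Thm. 0.8 (p. 318), Prop. 10.5 (4) (p. 356)]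
[cite: Rubin2000, Ch. I §3 and Thm. I.7.3; Ch. II Thm. 2.3 and Thms. 3.2–3.4; Ch. V §3]
[cite: MazurRubin2004, Thm. 2.3.4]
[cite: Lim2017FineSelmer, §3] [cite: CoatesSujatha2005, statement (A) (introduction and §3)]
[cite: BlochKato1990, §3 Def. 3.10, Ex. 3.11, Prop. 3.8]
[cite: MilneADT2006, I.2.6, I.4.10, II.2.9]
[cite: SilvermanAEC2009, IV.6.4, Thm. X.4.14] [cite: Tate1975, §1]
[cite: GreenbergLNM1716, Prop. 4.13; §3 after Lemma 3.3] -/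
def rankZero_padicValNat_sha_add_padicValNat_tamagawa_le_add_one_at_two_of_irreducible_of_fineSelmerDual_fg :
    Prop :=
  ∀ (W : WeierstrassCurve ℚ) [W.IsElliptic] [W.IsGloballyMinimal], ¬ W.HasCM →
    ¬ W.HasGoodReductionAtPrime 2 → ¬ W.HasMultiplicativeReductionAtPrime 2 →
    0 ≤ padicValRat 2 W.j →
    W.HasIrreducibleModPGaloisRep 2 →
    (∀ (κ : ZpExtension ℚ 2), κ.IsCyclotomic →
      ∃ (γ : Field.absoluteGaloisGroup ℚ) (D : W.FineSelmerDualData κ γ),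
        Module.Finite ℤ_[2] (RestrictScalars ℤ_[2] (IwasawaAlgebra 2) D.X)) →
    W.entireLFunction 1 ≠ 0 → Finite W.sha →
    ∃ q : ℚ, W.entireLFunction 1 / (W.realPeriodRat : ℂ) = (q : ℂ) ∧
      (padicValNat 2 (Nat.card (AddCommGroup.primaryComponent W.sha 2)) : ℤ) +
          padicValNat 2 W.tamagawaProduct ≤ padicValRat 2 q + 1

end Literature.NumberTheory.EllipticCurves.Kato2004


end
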